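import Literature.MathematicalPhysics.QuantumFieldTheory.Balaban1983to89.B9Thm310WholeDir

/-!
# `Balaban1983to89.B9RWSums346TwoDir` — the two-sided L² line ‖h∇_UG(U)∇\*_UJ‖ of (3.46) for Theorem 3.10's sum G(U), OVER THE DIRECTION LETTERS (R1′-A):
# n06-k's `B9RWSums346Two.l2line4_of_local310` with `Identities310₂`

T. Bałaban, *Propagators for lattice gauge theories in a background field*, Commun. Math. Phys. **99** (1985) 389–434
[`Balaban1985BackgroundPropagators`, "B9"], Thm 3.10 (3.105)–(3.108) pp. 414–416, (3.46) p. 398, (3.42) p. 397, Cor. 3.6 p. 408, p. 413; T. Bałaban,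
*Propagators and renormalization transformations for lattice gauge theories. II*, Commun. Math. Phys. **96** (1984) 223–250 [`Balaban1984PropagatorsII`, "[4]"],
(2.52)–(2.55) p. 232, Lemma 2.1 p. 234.

statement-level skeleton of published theorems with citation tags; proofs where landed; nothing here is a claim about the
Yang–Mills mass gap

WHY THIS FILE (cell `pub-ymgap`, Track A node N06 [B9], rows 19–21; seat `pub-ymgap-dag-n06-c` g11; LOCATED-9 bus l.32219 (R1′-A) and dag-n06-d g11's
LOCATED-R1A bus l.35122).  The rows-20–21 G₀ layer (`B9Thm312WholeFromThm310L2.thm33G0L2M_of_conv3107`, n06-l) reads the bundled two-sided L² line of the sum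
through n06-k's ONE-SLOT engine `l2line4_of_local310`, which takes `hi : Identities310`.  Over the direction letters the A-side structure conjunct is
`Identities310₂ 𝔬 𝔡 𝔩 R H U` (`B9Thm310WholeDir`); this file is the TYPE-ONLY re-thread of that one engine: the proof reads `hi` through the fixed point
(3.106) only (`Identities310₂.fixedPoint`); legs `L2TwoLegs310`, factors `FactorsL2_310`, the constant `twoConst` and every other hypothesis VERBATIM.  v1's two
private algebra helpers are copied (private there).  The per-pair engines of the lineage were re-threaded in `B9RWSums346SecondDiffDir` ∕ `B9RWSums346MixedPairGDir`
∕ `B9RWSums344InputPairGDir` ∕ `B9RWSums343HolderDir`.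

HONEST SCOPE.  Majorant bookkeeping over n06-k's landed L² calculus; Corollary 3.6's L² legs, the factor bounds and (3.105)–(3.106) are HYPOTHESES (schemas);
nothing of [B9] asserted; COUNT-NEUTRAL; N06 NOT discharged; one finite lattice programme — nothing continuum, nothing about OS positivity or the mass gap.
-/

namespace Literature.MathematicalPhysics.QuantumFieldTheory.Balaban1983to89.B9RWSums346TwoDir

open Finset B6RandomWalk B6RandomWalkHom B9Thm37Sum B9Thm34Ext B9Thm37Glue B9Thm37Whole B9Cor38Whole B9Thm310Whole
open B9RWSums343to347Whole B9RWSums346Schur B9Thm37GlueCor36 B9RWSums343Holder B9RWSums346Lap B9RWSums344Input B9RWSums346Two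
open B11SectG B9Thm37AllNorms B9SectDL2Decay B9Ineq347 B9Ineq347AllEntries
open B9RWSums346SecondDiff B9Thm37WholeDir B9Thm310WholeDir

noncomputable section

section Algebra

variable {g : B9.Geometry} [Fintype g.Site] {R : ℝ} {H : Prop} {X Y Z : Type}

/-- Algebra of (3.106) read through ∇_U on the left and ∇\*_U on the right (v1's private `twoSided_split₂`). [folklore] -/
private theorem twoSided_split₂' {Y' : Type} {E : (X → ℝ) →ₗ[ℝ] (Z → ℝ)} {Dst : (Y' → ℝ) →ₗ[ℝ] (X → ℝ)}
    {G G0 W : Module.End ℝ (X → ℝ)} (h : G = G0 + G * W) :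
    E ∘ₗ (G ∘ₗ Dst) = E ∘ₗ (G0 ∘ₗ Dst) + (E ∘ₗ G) ∘ₗ (W ∘ₗ Dst) := by
  conv_lhs => rw [h]
  apply LinearMap.ext
  intro μ
  simp only [LinearMap.comp_apply, LinearMap.add_apply, Module.End.mul_apply, map_add]

/-- L² block bounds add (v1's private `blockBd_add`). [folklore] -/
private theorem blockBd_add' [Fintype X] [Fintype Z] (blk₁ : X → g.Site) (blk₂ : Z → g.Site) {T₁ T₂ : (X → ℝ) →ₗ[ℝ] (Z → ℝ)}
    {K₁ K₂ : g.Site → g.Site → ℝ} (h₁ : BlockBd (g := toB6 g R H) blk₁ blk₂ T₁ K₁)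
    (h₂ : BlockBd (g := toB6 g R H) blk₁ blk₂ T₂ K₂) :
    BlockBd (g := toB6 g R H) blk₁ blk₂ (T₁ + T₂) (fun a b => K₁ a b + K₂ a b) := by
  rw [blockBd_iff_hasMaj] at h₁ h₂ ⊢
  exact h₁.add h₂

end Algebra

section GSide

variable {g : B9.Geometry} [Fintype g.Site] [DecidableEq g.Site] {R : ℝ} {H : Prop} {B : B9.Backgrounds}
variable {X Y ι A Dir : Type} [Fintype Dir]

/-- ★ **THE TWO-SIDED L² LINE OF (3.46) FOR THE SUM G(U) OF (3.107) AT ONE MEMBER AND ONE CONFIGURATION U, OVER THE DIRECTION LETTERS** —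
n06-k's `B9RWSums346Two.l2line4_of_local310` VERBATIM with `hi : Identities310₂ 𝔬 𝔡 𝔩 R H U` (read only through `Identities310₂.fixedPoint`): the L² block bound of
∇_UG∇\*_U: from (3.106) read as ∇_UG∇\*_U = ∇_UG₀∇\*_U + (∇_UG)(R∇\*_U), the L² legs summed with N₂, the sibling's L² block bound of
∇_UG (`B9RWSums346Schur.blockBd_entry1` from the pin's sup majorants of ∇_UG, G∇\*_U and the transpose letter), the factors' L² bounds
summed with N_F, and `tail_comp_l2` (transfer at the pin's (δ, α), convolution at (δ₁, α₁)): ‖1_{Δ(y)}∇_UG∇\*_Uμ‖₂ ≦ `twoConst …`·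
e^{−(1−2α)δd(y,y′)}‖μ‖₂ for supp μ ⊂ Δ(y′), provided 2αδ ≦ δ and (1 − 2α)δ ≦ (1 − α₁)δ₁.
[cite: Balaban1985BackgroundPropagators, Thm 3.10 (3.105)–(3.108) pp.414–416 + (3.46) p.398 + p.413 + p.391; Balaban1984PropagatorsII, (2.52)–(2.55) p.232 + Lemma 2.1 p.234] -/
theorem l2line4_of_local310_dir [Fintype X] [DecidableEq X] [Fintype Y] [DecidableEq Y] [Fintype ι] [Fintype A]
    (𝔬 : Ops310 g B X Y ι A) (𝔡 : DirOps310 𝔬 Dir) (𝔩 : DirLetters310 𝔬 Dir) (R : ℝ) (H : Prop) (d d₁ : ℕ) (δ α L₀ δ₁ α₁ ρ N N' NF Cℓ N2 B2 θ2 C : ℝ) (κ : Sizes310)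
    (S2 : ι → Finset g.Site) (U : B.Cfg)
    (hNF : 0 ≤ NF) (hN2 : 0 ≤ N2) (hB2 : 0 ≤ B2) (hθ2 : 0 ≤ θ2) (hM : 1 ≤ g.M) (hC : 0 ≤ C)
    (hα2 : 2 * α * δ ≤ δ) (hα₁δ₁ : 0 ≤ α₁ * δ₁) (hrate : (1 - 2 * α) * δ ≤ (1 - α₁) * δ₁)
    (hs : StaticOK310 𝔬 ρ N N' NF Cℓ κ) (hcnt2 : ∀ a : g.Site, (∑ i, if a ∈ S2 i then (1 : ℝ) else 0) ≤ N2)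
    (h261 : Ineq261 d₁ (toB6 g R H) δ₁ α₁) (hF : Facts347 g R H d δ α L₀) (hi : Identities310₂ 𝔬 𝔡 𝔩 R H U)
    (hL : L2TwoLegs310 𝔬 R H S2 B2 δ₁ U) (hFL : FactorsL2_310 𝔬 R H θ2 δ₁ U)
    (h1 : HasMajorantHom (g := toB6 g R H) 𝔬.blk 𝔬.blkY (𝔬.D U ∘ₗ 𝔬.G U)
      (fun (a b : g.Site) => C * g.len a * Real.exp (-(δ * g.dist a b))))
    (h2 : HasMajorantHom (g := toB6 g R H) 𝔬.blkY 𝔬.blk (𝔬.G U ∘ₗ 𝔬.Dstar U)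
      (fun (a b : g.Site) => C * g.len a * Real.exp (-(δ * g.dist a b))))
    (htr : IsTransposePair (𝔬.D U ∘ₗ 𝔬.G U) (𝔬.G U ∘ₗ 𝔬.Dstar U)) :
    BlockBd (g := toB6 g R H) 𝔬.blkY 𝔬.blkY (𝔬.D U ∘ₗ (𝔬.G U ∘ₗ 𝔬.Dstar U))
      (fun (a b : g.Site) => twoConst d₁ δ₁ α₁ N2 B2 NF θ2 C L₀ * Real.exp (-((1 - 2 * α) * δ * g.dist a b))) := by
  have hMpos : 0 < g.M := lt_of_lt_of_le one_pos hM
  have hMinv : g.M⁻¹ ≤ 1 := inv_le_one_of_one_le₀ hM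
  have hMinv0 : 0 ≤ g.M⁻¹ := inv_nonneg.mpr hMpos.le
  have hlen0 : ∀ y : g.Site, 0 ≤ g.len y := fun y => (hs.lenpos y).le
  have htri : Triangle254 (toB6 g R H) := fun a b c => hs.tri a b c
  have hc1 : 0 ≤ B6.c1 d₁ δ₁ α₁ := c1_nonneg d₁ δ₁ α₁
  have hL₀ : 0 ≤ L₀ := le_trans (le_trans zero_le_one hF.one_le_L) hF.L_le
  have hρ'0 : 0 ≤ (1 - 2 * α) * δ := by nlinarith [hα2]
  have hexp : ∀ a b : g.Site, Real.exp (-(δ₁ * g.dist a b)) ≤ Real.exp (-((1 - 2 * α) * δ * g.dist a b)) := fun a b =>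
    Real.exp_le_exp.mpr (neg_le_neg (mul_le_mul_of_nonneg_right (by nlinarith [hrate, hα₁δ₁]) (hs.dnn a b)))
  -- (3.106)
  have hfix : 𝔬.G U = (∑ i, mulOp (𝔬.h i) * 𝔬.Gsq U i * mulOp (𝔬.h i)) + 𝔬.G U * ∑ a, 𝔬.Rf U a :=
    hi.fixedPoint
  have hsumE : 𝔬.D U ∘ₗ ((∑ i, mulOp (𝔬.h i) * 𝔬.Gsq U i * mulOp (𝔬.h i)) ∘ₗ 𝔬.Dstar U) =
      ∑ i, 𝔬.D U ∘ₗ ((mulOp (𝔬.h i) * 𝔬.Gsq U i * mulOp (𝔬.h i)) ∘ₗ 𝔬.Dstar U) := by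
    apply LinearMap.ext
    intro μ
    simp only [LinearMap.comp_apply, LinearMap.sum_apply, map_sum]
  -- the factors R_a∇* summed with N_F
  have hsumF : (∑ a, 𝔬.Rf U a) ∘ₗ 𝔬.Dstar U = ∑ a, 𝔬.Rf U a ∘ₗ 𝔬.Dstar U := by
    apply LinearMap.ext
    intro μ
    simp only [LinearMap.comp_apply, LinearMap.sum_apply]
  have hP : BlockBd (g := toB6 g R H) 𝔬.blkY 𝔬.blk ((∑ a, 𝔬.Rf U a) ∘ₗ 𝔬.Dstar U)
      (fun (y y' : g.Site) => NF * (θ2 * g.M⁻¹) * (g.len y)⁻¹ * Real.exp (-(δ₁ * g.dist y y'))) := by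
    rw [hsumF]
    have h := blockBd_localSum (R := R) (H := H) 𝔬.blkY 𝔬.blk (fun a => 𝔬.Rf U a ∘ₗ 𝔬.Dstar U)
      (fun a (y : g.Site) => if y ∈ 𝔬.SF a then (1 : ℝ) else 0)
      (fun (y y' : g.Site) => θ2 * g.M⁻¹ * (g.len y)⁻¹ * Real.exp (-(δ₁ * g.dist y y'))) NF
      (fun y y' => mul_nonneg (mul_nonneg (mul_nonneg hθ2 hMinv0) (inv_nonneg.mpr (hlen0 y))) (Real.exp_nonneg _))
      hFL.facD hs.cntF
    exact h.mono fun y y' => le_of_eq (by ring)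
  -- the L² bound of ∇_UG by the Schur test of the sibling
  have hS := blockBd_entry1 hF hC hs.symm hs.lenpos 𝔬.blk 𝔬.blkY h1 h2 htr
  have hρ : (1 - α) * δ = α * δ + (1 - 2 * α) * δ := by ring
  have htail := tail_comp_l2 (R := R) (H := H) 𝔬.blk 𝔬.blkY 𝔬.blkY hF h261 htri hs.symm hs.dnn hs.lenpos (mul_nonneg hC hL₀)
    (mul_nonneg hNF (mul_nonneg hθ2 hMinv0)) hρ hρ'0 hrate hS hP
  have hhead := blockBd_localSum (R := R) (H := H) 𝔬.blkY 𝔬.blkY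
    (fun i => 𝔬.D U ∘ₗ ((mulOp (𝔬.h i) * 𝔬.Gsq U i * mulOp (𝔬.h i)) ∘ₗ 𝔬.Dstar U))
    (fun i (a : g.Site) => if a ∈ S2 i then (1 : ℝ) else 0) (fun (a b : g.Site) => B2 * Real.exp (-(δ₁ * g.dist a b))) N2
    (fun a b => mul_nonneg hB2 (Real.exp_nonneg _)) hL.l4 hcnt2
  rw [twoSided_split₂' hfix, hsumE]
  refine (blockBd_add' (R := R) (H := H) 𝔬.blkY 𝔬.blkY hhead htail).mono fun a b => ?_
  have hK0 : 0 ≤ N2 * B2 := mul_nonneg hN2 hB2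
  have ht : C * L₀ * (NF * (θ2 * g.M⁻¹)) * L₀ * B6.c1 d₁ δ₁ α₁ ≤ C * L₀ * (NF * θ2) * L₀ * B6.c1 d₁ δ₁ α₁ := by
    have h3 : θ2 * g.M⁻¹ ≤ θ2 := by
      calc θ2 * g.M⁻¹ ≤ θ2 * 1 := mul_le_mul_of_nonneg_left hMinv hθ2
        _ = θ2 := mul_one _
    have h4 : C * L₀ * (NF * (θ2 * g.M⁻¹)) ≤ C * L₀ * (NF * θ2) :=
      mul_le_mul_of_nonneg_left (mul_le_mul_of_nonneg_left h3 hNF) (mul_nonneg hC hL₀)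
    exact mul_le_mul_of_nonneg_right (mul_le_mul_of_nonneg_right h4 hL₀) hc1
  calc N2 * (B2 * Real.exp (-(δ₁ * g.dist a b))) +
        C * L₀ * (NF * (θ2 * g.M⁻¹)) * L₀ * B6.c1 d₁ δ₁ α₁ * Real.exp (-((1 - 2 * α) * δ * g.dist a b))
      = N2 * B2 * Real.exp (-(δ₁ * g.dist a b)) +
        C * L₀ * (NF * (θ2 * g.M⁻¹)) * L₀ * B6.c1 d₁ δ₁ α₁ * Real.exp (-((1 - 2 * α) * δ * g.dist a b)) := by ring
    _ ≤ N2 * B2 * Real.exp (-((1 - 2 * α) * δ * g.dist a b)) +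
        C * L₀ * (NF * θ2) * L₀ * B6.c1 d₁ δ₁ α₁ * Real.exp (-((1 - 2 * α) * δ * g.dist a b)) :=
        add_le_add (mul_le_mul_of_nonneg_left (hexp a b) hK0) (mul_le_mul_of_nonneg_right ht (Real.exp_nonneg _))
    _ = twoConst d₁ δ₁ α₁ N2 B2 NF θ2 C L₀ * Real.exp (-((1 - 2 * α) * δ * g.dist a b)) := by
        unfold twoConst; ring

end GSide

end

end Literature.MathematicalPhysics.QuantumFieldTheory.Balaban1983to89.B9RWSums346TwoDir
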